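import Literature.Barriers.AtomisticToContinuum.HardDiskTranslationInvariance
import HarnessLib

/-!
# Richthammer's translation-invariance theorem for hard discs: the two printed steps and the
# assembly (Richthammer 2007, §3.5 Lemma 5, (3.5), §5.5, Lemma 3)

Companion of `HardDiskTranslationInvariance.lean` (provefact
`Literature.Barriers.AtomisticToContinuum.HardDisk.Richthammer2007_hardDisk`, Richthammer 2007,
Theorem 1 for the Euclidean hard disc). The printed proof of Theorem 1 has exactly two
ingredients, which this file vendors as named facts, and a short assembly, which it proves:

* `Richthammer2007_lemma5` (named fact) — the sufficient condition for the conservation of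
  `τ̂`-symmetry [Richthammer2007, §3.5 Lemma 5; proof §4.3 "exactly as Proposition (9.1) in [G]",
  by the extremal decomposition of Gibbs measures, Georgii Thms 7.7 and 7.26, on the standard
  Borel space `(𝒳, 𝓕_𝒳)`]: if `μ(D + τ̂) + μ(D - τ̂) ≥ μ(D)` for all cylinder events
  `D ∈ 𝓕_{𝒳,Λ_m}`, `m ∈ ℕ`, and all Gibbs measures `μ`, then every Gibbs measure is `τ̂`-invariant;
* `Richthammer2007_ineq35` (named fact) — the estimate (3.5) itself, established in §5 (Lemmas
  7–13, the hard-core preserving generalised translation `𝔗_n`) for the translations `τ e_i`,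
  `τ ∈ [0, 1/2]`, `i = 1, 2` [Richthammer2007, §5.1 and §5.5: (5.8) and "we get the estimate (3.5)
  by taking the limit `δ → 0`"];
* `Richthammer2007_hardDisk_of_lemma5_of_ineq35` (**proved**) — "Now the claim of the theorem
  follows from Lemma 5" together with "`ℝ²` is generated by the set
  `{τ_i e_i : 0 ≤ τ_i < 1/2, i ∈ {1,2}}`, so we only have to consider translations of this special
  form" [Richthammer2007, §3.5 and §5.5]: the translations leaving every Gibbs measure invariant
  form a subgroup of `ℝ²` (`Measure.map_map`), which contains the generators by the two facts.
* `Richthammer2007_lemma3` (named fact) — the Ruelle/Campbell bound used throughout §6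
  [Richthammer2007, §3.3 Lemma 3 with the Ruelle bound `ξ = 1` of Lemma 4 (a) for `U ≥ 0`]:
  `∫ μ(dX) ∑≠_{x₁,…,x_m ∈ X} f(x₁,…,x_m) ≤ z^m ∫ f dx` for every Gibbs measure of the hard-disc
  model and measurable `f ≥ 0`; vendored here as the first target of the bottom-up programme.

Also here: the boxes `Λ_r = [-r, r[²` (`box`), the cylinder σ-algebras
`𝓕_{𝒳,Λ} = e_Λ⁻¹ 𝓕'_{𝒳,Λ}` (`IsCylinderEvent Λ D`, the pull-back of the count σ-algebra under the
restriction map `e_Λ : X ↦ X_Λ`, [Richthammer2007, §3.2]) with their monotonicity and stability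
under translation, and the elementary algebra of `PointConfig.translate` (composition, inverse).

What is NOT here: the proofs of Lemma 5 (extremal decomposition) and of (3.5) (§5–§6); the plan
for them is kept in the provefact notes. The factor-two variant of Lemma 5 that avoids the
extremal decomposition is proved in `HardDiskTranslationCriterion.lean`.

## References

* [Richthammer2007] T. Richthammer, *Translation-invariance of two-dimensional Gibbsian point
  processes*, Comm. Math. Phys. 274 (2007) 81–122, arXiv:0706.3637: §2 Theorem 1 (p. 4), §3.2
  (p. 6, `𝓕_{𝒳,Λ}`), §3.3 Lemma 3 and (3.4) (p. 7), §3.4 Lemma 4 (a) (p. 8), §3.5 Lemma 5 and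
  (3.5) (p. 8), §4.3 (p. 10), §5.1 (p. 10), §5.5 (5.8)–(5.9) (p. 12).
* [Georgii2011] H.-O. Georgii, *Gibbs Measures and Phase Transitions*, de Gruyter 1988 (2nd ed.
  2011), Prop. 9.1, Thms 7.7, 7.26 — cited through [Richthammer2007, §4.3]; not re-read here.
-/

noncomputable section

open MeasureTheory Set
open scoped ENNReal

/-! ### Algebra of translations of point configurations -/

namespace Literature.Analysis.FunctionSpaces.PointConfig

variable {E : Type*} [TopologicalSpace E] [AddGroup E] [ContinuousAdd E]

/-- Membership in a translated configuration: `x ∈ c + v ↔ x - v ∈ c` (dot-notation extension of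
the tree's `PointConfig.translate`, declared from `Literature/Barriers`). [folklore] -/
theorem mem_translate_iff {v : E} {c : PointConfig E} {x : E} :
    x ∈ c.translate v ↔ x - v ∈ c := by
  change x ∈ (fun y => y + v) '' c.carrier ↔ _
  constructor
  · rintro ⟨y, hy, rfl⟩
    simpa using hy
  · intro hx
    exact ⟨x - v, hx, sub_add_cancel x v⟩

/-- Translating by `v` and then by `w` is translating by `v + w`. [folklore] -/
theorem translate_translate (v w : E) (c : PointConfig E) :
    (c.translate v).translate w = c.translate (v + w) := by
  ext x
  change x ∈ (fun y => y + w) '' ((fun y => y + v) '' c.carrier) ↔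
    x ∈ (fun y => y + (v + w)) '' c.carrier
  rw [Set.image_image]
  simp only [add_assoc]

/-- As maps of configuration space, `g_w ∘ g_v = g_{v+w}`. [folklore] -/
theorem translate_comp_translate (v w : E) :
    (PointConfig.translate w ∘ PointConfig.translate v : PointConfig E → PointConfig E) =
      PointConfig.translate (v + w) :=
  funext fun c => translate_translate v w c

/-- Translation by `0` is the identity. [folklore] -/
theorem translate_zero_eq_id : (PointConfig.translate (0 : E) : PointConfig E → PointConfig E) = id := by
  funext c
  ext x
  simp [mem_translate_iff]

/-- `g_{-v} ∘ g_v = id`. [folklore] -/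
theorem translate_neg_comp_translate (v : E) :
    (PointConfig.translate (-v) ∘ PointConfig.translate v : PointConfig E → PointConfig E) = id := by
  rw [translate_comp_translate, add_neg_cancel, translate_zero_eq_id]

/-- Restriction after translation: `(X + u)_Λ = (X_{Λ - u}) + u`. [folklore] -/
theorem restrict_translate (Λ : Set E) (u : E) (c : PointConfig E) :
    (c.translate u).restrict Λ = (c.restrict ((fun y => y + u) ⁻¹' Λ)).translate u := by
  ext x
  change x ∈ (fun y => y + u) '' c.carrier ∩ Λ ↔ x ∈ (fun y => y + u) '' (c.carrier ∩ (fun y => y + u) ⁻¹' Λ)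
  rw [Set.image_inter_preimage]

omit [AddGroup E] [ContinuousAdd E] in
/-- Restricting to `P ⊆ Λ'` factors through restricting to `Λ'`. [folklore] -/
theorem restrict_restrict_of_subset {P Λ' : Set E} (h : P ⊆ Λ') (c : PointConfig E) :
    (c.restrict Λ').restrict P = c.restrict P := by
  ext x
  change x ∈ (c.carrier ∩ Λ') ∩ P ↔ x ∈ c.carrier ∩ P
  constructor
  · rintro ⟨⟨hc, -⟩, hP⟩
    exact ⟨hc, hP⟩
  · rintro ⟨hc, hP⟩
    exact ⟨⟨hc, h hP⟩, hP⟩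

end Literature.Analysis.FunctionSpaces.PointConfig

namespace Literature.Barriers.AtomisticToContinuum.HardDisk

open Literature.Analysis.FunctionSpaces

/-- The plane. -/
local notation "E2" => EuclideanSpace ℝ (Fin 2)

/-! ### Boxes and cylinder events -/

/-- The centred half-open square `Λ_r = [-r, r[²` (Richthammer 2007, §3.1).
[cite: Richthammer2007, §3.1 (p. 5)] -/
def box (r : ℝ) : Set E2 := {x | ∀ i, -r ≤ x i ∧ x i < r}

/-- Membership in `Λ_r`. [cite: Richthammer2007, §3.1 (p. 5)] -/
theorem mem_box {r : ℝ} {x : E2} : x ∈ box r ↔ ∀ i, -r ≤ x i ∧ x i < r := Iff.rfl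

/-- `Λ_r` is a Borel set. [folklore] -/
theorem measurableSet_box (r : ℝ) : MeasurableSet (box r) := by
  have : box r = ⋂ i : Fin 2, (fun x : E2 => x i) ⁻¹' Set.Ico (-r) r := by
    ext x; simp [box, Set.mem_Ico]
  rw [this]
  exact MeasurableSet.iInter fun i =>
    (PiLp.continuous_apply 2 (fun _ : Fin 2 => ℝ) i).measurable measurableSet_Ico

/-- The boxes increase with `r`. [folklore] -/
theorem box_mono {r r' : ℝ} (h : r ≤ r') : box r ⊆ box r' :=
  fun _ hx i => ⟨by linarith [(hx i).1], by linarith [(hx i).2]⟩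

/-- `Λ_r` is bounded (it lies in the closed ball of radius `2r` for the Euclidean norm). [folklore] -/
theorem isBounded_box (r : ℝ) : Bornology.IsBounded (box r) := by
  rw [Metric.isBounded_iff_subset_closedBall (0 : E2)]
  refine ⟨2 * |r|, fun x hx => ?_⟩
  rw [Metric.mem_closedBall, dist_zero_right, EuclideanSpace.norm_eq]
  simp only [Real.norm_eq_abs, sq_abs]
  have hcoord : ∀ i, x i ^ 2 ≤ r ^ 2 := fun i => by
    have h1 := (hx i).1
    have h2 := (hx i).2
    nlinarith [sq_nonneg (x i), sq_abs r, abs_nonneg r, le_abs_self r, neg_abs_le r]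
  have hsum : ∑ i : Fin 2, x i ^ 2 ≤ (2 * |r|) ^ 2 := by
    rw [Fin.sum_univ_two]
    nlinarith [hcoord 0, hcoord 1, sq_abs r]
  calc Real.sqrt (∑ i : Fin 2, x i ^ 2) ≤ Real.sqrt ((2 * |r|) ^ 2) := Real.sqrt_le_sqrt hsum
    _ = 2 * |r| := Real.sqrt_sq (by positivity)

/-- The boxes `Λ_m`, `m ∈ ℕ`, exhaust the plane. [folklore] -/
theorem exists_mem_box (x : E2) : ∃ m : ℕ, x ∈ box m := by
  obtain ⟨m, hm⟩ := exists_nat_gt (|x 0| + |x 1|)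
  refine ⟨m, fun i => ?_⟩
  have hi : |x i| ≤ |x 0| + |x 1| := by
    fin_cases i
    · exact le_add_of_nonneg_right (abs_nonneg _)
    · exact le_add_of_nonneg_left (abs_nonneg _)
  constructor
  · linarith [neg_abs_le (x i)]
  · linarith [le_abs_self (x i)]

/-- **Cylinder events in `Λ`**: `D ∈ 𝓕_{𝒳,Λ} := e_Λ⁻¹ 𝓕'_{𝒳,Λ}`, the σ-algebra obtained from the
(trace of the) count σ-algebra on configurations in `Λ` by the restriction map
`e_Λ : X ↦ X_Λ` — i.e. `D` is the preimage under `X ↦ X_Λ` of a measurable set of configurations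
(Richthammer 2007, §3.2). [cite: Richthammer2007, §3.2 (p. 6)] -/
def IsCylinderEvent (Λ : Set E2) (D : Set (PointConfig E2)) : Prop :=
  MeasurableSet[MeasurableSpace.comap (PointConfig.restrict Λ) inferInstance] D

/-- Unfolding: a cylinder event in `Λ` is `e_Λ⁻¹(A)` for a measurable `A`. [cite: Richthammer2007, §3.2 (p. 6)] -/
theorem isCylinderEvent_iff {Λ : Set E2} {D : Set (PointConfig E2)} :
    IsCylinderEvent Λ D ↔ ∃ A : Set (PointConfig E2), MeasurableSet A ∧ PointConfig.restrict Λ ⁻¹' A = D :=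
  MeasurableSpace.measurableSet_comap

/-- Cylinder events (in a measurable `Λ`) are events. [folklore] -/
theorem IsCylinderEvent.measurableSet {Λ : Set E2} (hΛ : MeasurableSet Λ) {D : Set (PointConfig E2)}
    (hD : IsCylinderEvent Λ D) : MeasurableSet D := by
  obtain ⟨A, hA, rfl⟩ := isCylinderEvent_iff.1 hD
  exact PointConfig.measurable_restrict hΛ hA

/-- `𝓕_{𝒳,Λ} ⊆ 𝓕_{𝒳,Λ'}` for measurable `Λ ⊆ Λ'`. [folklore] -/
theorem IsCylinderEvent.mono {Λ Λ' : Set E2} (hΛ : MeasurableSet Λ) (h : Λ ⊆ Λ') {D : Set (PointConfig E2)}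
    (hD : IsCylinderEvent Λ D) : IsCylinderEvent Λ' D := by
  obtain ⟨A, hA, rfl⟩ := isCylinderEvent_iff.1 hD
  refine isCylinderEvent_iff.2 ⟨PointConfig.restrict Λ ⁻¹' A, PointConfig.measurable_restrict hΛ hA, ?_⟩
  ext c
  simp only [Set.mem_preimage, PointConfig.restrict_restrict_of_subset h]

/-- Cylinder events are stable under translation, at the cost of enlarging the window: if
`Λ - u ⊆ Λ'` then `g_u⁻¹(D) ∈ 𝓕_{𝒳,Λ'}` for `D ∈ 𝓕_{𝒳,Λ}`. [folklore] -/
theorem IsCylinderEvent.preimage_translate {Λ Λ' : Set E2} (hΛ : MeasurableSet Λ) (u : E2)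
    (h : (fun y => y + u) ⁻¹' Λ ⊆ Λ') {D : Set (PointConfig E2)} (hD : IsCylinderEvent Λ D) :
    IsCylinderEvent Λ' (PointConfig.translate u ⁻¹' D) := by
  obtain ⟨A, hA, rfl⟩ := isCylinderEvent_iff.1 hD
  have hP : MeasurableSet ((fun y : E2 => y + u) ⁻¹' Λ) := (measurable_add_const u) hΛ
  refine isCylinderEvent_iff.2
    ⟨(PointConfig.translate u ∘ PointConfig.restrict ((fun y => y + u) ⁻¹' Λ)) ⁻¹' A,
      ((PointConfig.measurable_translate u).comp (PointConfig.measurable_restrict hP)) hA, ?_⟩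
  ext c
  simp only [Set.mem_preimage, Function.comp_apply, PointConfig.restrict_restrict_of_subset h,
    PointConfig.restrict_translate]

/-- The window arithmetic for boxes: `Λ_m - u ⊆ Λ_{m + ⌈|u₁|⌉ + ⌈|u₂|⌉}`. [folklore] -/
theorem preimage_add_box_subset (m : ℕ) (u : E2) :
    (fun y => y + u) ⁻¹' box m ⊆ box ((m + ⌈|u 0|⌉₊ + ⌈|u 1|⌉₊ : ℕ) : ℝ) := by
  intro x hx i
  have hxi := hx i
  simp only [PiLp.add_apply] at hxi
  have hu : |u i| ≤ (⌈|u 0|⌉₊ : ℝ) + ⌈|u 1|⌉₊ := by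
    fin_cases i
    · exact le_add_of_le_of_nonneg (Nat.le_ceil _) (Nat.cast_nonneg _)
    · exact le_add_of_nonneg_of_le (Nat.cast_nonneg _) (Nat.le_ceil _)
  push_cast
  constructor
  · linarith [hxi.1, le_abs_self (u i)]
  · linarith [hxi.2, neg_abs_le (u i)]

/-- Hence translates of cylinder events in `Λ_m` are cylinder events in a larger box. [folklore] -/
theorem IsCylinderEvent.preimage_translate_box {m : ℕ} (u : E2) {D : Set (PointConfig E2)}
    (hD : IsCylinderEvent (box m) D) :
    IsCylinderEvent (box ((m + ⌈|u 0|⌉₊ + ⌈|u 1|⌉₊ : ℕ) : ℝ)) (PointConfig.translate u ⁻¹' D) :=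
  hD.preimage_translate (measurableSet_box _) u (preimage_add_box_subset m u)

/-! ### The two printed steps, as named facts -/

/-- **Richthammer 2007, Lemma 5 (sufficient condition for the conservation of `τ̂`-symmetry),
for the hard-disc model.** "Let `(U, z, 𝒳𝒳)` be admissible, where `U` is a translation-invariant
potential. If for all cylinder events `D ∈ 𝓕_{𝒳,Λ_m}` (`m ∈ ℕ`) and all Gibbs measures
`μ ∈ 𝒢_{𝒳𝒳}(U, z)` we have `μ(D + τ̂) + μ(D - τ̂) ≥ μ(D)` (3.5), then every Gibbs measure
`μ ∈ 𝒢_{𝒳𝒳}(U, z)` is `τ̂`-invariant", specialised to `U = U_hc` (Euclidean unit disc), `z > 0`,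
`𝒳𝒳 = 𝒳` (admissible with Ruelle bound `1`, Lemma 4 (a)). Here `D - τ̂ = g_τ̂⁻¹(D)` and
`D + τ̂ = g_{-τ̂}⁻¹(D)` with `g_τ̂(X) = X + τ̂`, and `τ̂`-invariance is `μ ∘ g_τ̂⁻¹ = μ`. The printed
proof (§4.3) is Georgii's Prop. 9.1: extremal decomposition (Thm 7.26) on the standard Borel space
`(𝒳, 𝓕_𝒳)` and the tail-triviality dichotomy (Thm 7.7).
[cite: Richthammer2007, §3.5 Lemma 5 (p. 8) and §4.3 (p. 10)] -/
def Richthammer2007_lemma5 : Prop :=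
  ∀ z : ℝ, 0 < z → ∀ τ : E2,
    (∀ μ : Measure (PointConfig E2), IsGibbs z μ → ∀ m : ℕ, ∀ D : Set (PointConfig E2),
        IsCylinderEvent (box m) D →
          μ D ≤ μ (PointConfig.translate τ ⁻¹' D) + μ (PointConfig.translate (-τ) ⁻¹' D)) →
      ∀ μ : Measure (PointConfig E2), IsGibbs z μ → μ.map (PointConfig.translate τ) = μ

/-- **Richthammer 2007, estimate (3.5) for the hard-disc model** (the content of §5, "Proof of
Theorem 1: main steps", Lemmas 7–13): for every activity `z > 0`, every Gibbs measure `μ` of the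
planar hard-disc model, every direction `e = e₁` or `e₂`, every `τ ∈ [0, 1/2]` and every cylinder
event `D ∈ 𝓕_{𝒳,Λ_{n'-1}}`, `n' ∈ ℕ`: `μ(D - τe) + μ(D + τe) ≥ μ(D)` — obtained from
`μ(𝔗̄_n(D ∩ G_n)) + μ(𝔗_n(D ∩ G_n)) ≥ μ(D ∩ G_n)` (5.8), `𝔗_n(D ∩ G_n) ⊆ D + τe`,
`𝔗̄_n(D ∩ G_n) ⊆ D - τe`, `μ(G_nᶜ) ≤ δ` (Lemma 13) and `δ → 0`.
[cite: Richthammer2007, §5.1 (p. 10) and §5.5 (5.8)–(5.9) (p. 12)] -/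
def Richthammer2007_ineq35 : Prop :=
  ∀ z : ℝ, 0 < z → ∀ μ : Measure (PointConfig E2), IsGibbs z μ →
    ∀ i : Fin 2, ∀ t : ℝ, 0 ≤ t → t ≤ 1 / 2 → ∀ m : ℕ, ∀ D : Set (PointConfig E2),
      IsCylinderEvent (box m) D →
        μ D ≤ μ (PointConfig.translate (t • EuclideanSpace.single i (1 : ℝ)) ⁻¹' D) +
          μ (PointConfig.translate (-(t • EuclideanSpace.single i (1 : ℝ))) ⁻¹' D)

/-- **Richthammer 2007, Lemma 3 with the Ruelle bound `ξ = 1` of Lemma 4 (a), for the hard-disc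
model** (property of the Ruelle bound): for every Gibbs measure `μ` of the planar hard-disc model
at activity `z > 0` and every measurable `f : (ℝ²)^m → [0, ∞]`, `m ∈ ℕ`,
`∫ μ(dX) ∑≠_{x₁,…,x_m ∈ X} f(x₁,…,x_m) ≤ z^m ∫ dx₁⋯dx_m f(x₁,…,x_m)` (3.4), the sum running over
pairwise distinct points (rendered, as in `IsPoissonPointProcess.multivariateMecke`, by the `tsum`
over injective `x : Fin m → ℝ²` with values in `X`). Lemma 4 (a): a purely repulsive `U ≥ 0` makes
`(U, z, 𝒳)` admissible with Ruelle bound `ξ := 1`, "a straightforward consequence of the fact that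
all energy terms are nonnegative"; Lemma 3 is proved in §4.2 from the DLR equation in `Λ_n` and
the Poisson formula, letting `n → ∞`.
[cite: Richthammer2007, §3.3 Lemma 3 (3.4) (p. 7), §3.4 Lemma 4 (a) (p. 8), §4.2 (p. 9)] -/
def Richthammer2007_lemma3 : Prop :=
  ∀ z : ℝ, 0 < z → ∀ μ : Measure (PointConfig E2), IsGibbs z μ →
    ∀ (m : ℕ) (f : (Fin m → E2) → ℝ≥0∞), Measurable f →
      ∫⁻ X, (∑' x : {x : Fin m → E2 // Function.Injective x ∧ ∀ i, x i ∈ X}, f x.1) ∂μ ≤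
        ENNReal.ofReal z ^ m * ∫⁻ x, f x ∂(Measure.pi fun _ : Fin m => (volume : Measure E2))

/-! ### The assembly: Theorem 1 from Lemma 5 and (3.5) -/

/-- The translations leaving every Gibbs measure at activity `z` invariant. [folklore] -/
def invariantShifts (z : ℝ) : Set E2 :=
  {τ | ∀ μ : Measure (PointConfig E2), IsGibbs z μ → μ.map (PointConfig.translate τ) = μ}

/-- `0` is an invariant shift. [folklore] -/
theorem zero_mem_invariantShifts (z : ℝ) : (0 : E2) ∈ invariantShifts z := fun μ _ => by
  rw [PointConfig.translate_zero_eq_id, Measure.map_id]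

/-- Invariant shifts are closed under addition (`g_{σ+τ} = g_τ ∘ g_σ`). [folklore] -/
theorem add_mem_invariantShifts {z : ℝ} {σ τ : E2} (hσ : σ ∈ invariantShifts z)
    (hτ : τ ∈ invariantShifts z) : σ + τ ∈ invariantShifts z := fun μ hμ => by
  rw [← PointConfig.translate_comp_translate σ τ,
    ← Measure.map_map (PointConfig.measurable_translate τ) (PointConfig.measurable_translate σ),
    hσ μ hμ, hτ μ hμ]

/-- Invariant shifts are closed under negation (`g_{-τ} = g_τ⁻¹`). [folklore] -/
theorem neg_mem_invariantShifts {z : ℝ} {τ : E2} (hτ : τ ∈ invariantShifts z) :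
    -τ ∈ invariantShifts z := fun μ hμ => by
  conv_lhs => rw [← hτ μ hμ]
  rw [Measure.map_map (PointConfig.measurable_translate (-τ)) (PointConfig.measurable_translate τ),
    PointConfig.translate_neg_comp_translate, Measure.map_id]

/-- Invariant shifts are closed under natural multiples. [folklore] -/
theorem nsmul_mem_invariantShifts {z : ℝ} {τ : E2} (hτ : τ ∈ invariantShifts z) (n : ℕ) :
    (n : ℝ) • τ ∈ invariantShifts z := by
  induction n with
  | zero => simpa using zero_mem_invariantShifts z
  | succ n ih =>
    have : ((n + 1 : ℕ) : ℝ) • τ = (n : ℝ) • τ + τ := by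
      rw [Nat.cast_succ, add_smul, one_smul]
    rw [this]
    exact add_mem_invariantShifts ih hτ

/-- If all small shifts `t e`, `t ∈ [0, 1/2]`, in a direction `e` are invariant, so is the whole
line `ℝ e` ("`ℝ²` is generated by `{τ_i e_i : 0 ≤ τ_i < 1/2}`", Richthammer 2007, §3.5). [cite: Richthammer2007, §3.5 (p. 8)] -/
theorem smul_mem_invariantShifts_of_small {z : ℝ} {e : E2}
    (h : ∀ t : ℝ, 0 ≤ t → t ≤ 1 / 2 → t • e ∈ invariantShifts z) (t : ℝ) :
    t • e ∈ invariantShifts z := by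
  -- nonnegative multiples first
  have hpos : ∀ s : ℝ, 0 ≤ s → s • e ∈ invariantShifts z := by
    intro s hs
    set n : ℕ := ⌈2 * s⌉₊ + 1 with hn
    have hn0 : (0 : ℝ) < n := by rw [hn]; positivity
    have hsn : s / n ≤ 1 / 2 := by
      rw [div_le_iff₀ hn0, hn]
      push_cast
      linarith [Nat.le_ceil (2 * s)]
    have hmem := nsmul_mem_invariantShifts (h (s / n) (div_nonneg hs hn0.le) hsn) n
    have hs' : (n : ℝ) • (s / n) • e = s • e := by
      rw [smul_smul, mul_div_cancel₀ s hn0.ne']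
    rwa [hs'] at hmem
  rcases le_or_gt 0 t with ht | ht
  · exact hpos t ht
  · have := neg_mem_invariantShifts (hpos (-t) (by linarith))
    rwa [neg_smul, neg_neg] at this

/-- **Assembly of Richthammer's Theorem 1 for hard discs from its two printed ingredients.**
Given Lemma 5 and the estimate (3.5) for the generating translations `τ e_i`, `τ ∈ [0, 1/2]`,
every Gibbs measure of the planar hard-disc model at every activity `z > 0` is invariant under all
translations: the invariant shifts form a subgroup of `ℝ²` containing `[0, 1/2] e₁ ∪ [0, 1/2] e₂`,
hence all of `ℝ² = ℝ e₁ + ℝ e₂`. [cite: Richthammer2007, §3.5 (p. 8) and §5.5 (p. 12)] -/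
theorem Richthammer2007_hardDisk_of_lemma5_of_ineq35 (h5 : Richthammer2007_lemma5)
    (h35 : Richthammer2007_ineq35) : Richthammer2007_hardDisk := by
  intro z hz μ hμ τ
  have hgen : ∀ (i : Fin 2) (t : ℝ), 0 ≤ t → t ≤ 1 / 2 →
      t • EuclideanSpace.single i (1 : ℝ) ∈ invariantShifts z :=
    fun i t ht0 ht1 μ' hμ' =>
      h5 z hz _ (fun ν hν m D hD => h35 z hz ν hν i t ht0 ht1 m D hD) μ' hμ'
  have hline : ∀ (i : Fin 2) (t : ℝ), t • EuclideanSpace.single i (1 : ℝ) ∈ invariantShifts z :=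
    fun i => smul_mem_invariantShifts_of_small (hgen i)
  have hτ : τ = τ 0 • EuclideanSpace.single 0 (1 : ℝ) + τ 1 • EuclideanSpace.single 1 (1 : ℝ) := by
    ext j
    fin_cases j <;> simp
  have hmem : τ ∈ invariantShifts z := by
    rw [hτ]
    exact add_mem_invariantShifts (hline 0 (τ 0)) (hline 1 (τ 1))
  exact hmem μ hμ

end Literature.Barriers.AtomisticToContinuum.HardDisk

end
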